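import Literature.AnabelianGeometry.EtaleTheta.TemperedRigidity
import Literature.AnabelianGeometry.SemiGraphs.TemperedCompletionExtension
import Literature.AnabelianGeometry.SemiGraphs.TemperedDLocTransport
import Mathlib.GroupTheory.Commutator.Basic

/-!
# [EtTh] Thm 1.6 (ii): the THETA COMPANION of an automorphism of `Π^tp_X` preserving `Δ^tp_X`, CONSTRUCTED
# (companion of `TemperedRigidity.lean`; support for GAP row G-w4d010-2 (R1b) of the abc-iut cell)

Mochizuki, *The étale theta function and its Frobenioid-theoretic manifestations*, Publ. RIMS **45** (2009)
[EtTh], §1: the setting of PRIMS PDF p. 12 («we shall write `Π^tp_X ↠ (Π^tp_X)^Θ ↠ (Π^tp_X)^ell` for the quotients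
whose kernels are the kernels of the quotients `Δ^tp_X ↠ (Δ^tp_X)^Θ ↠ (Δ^tp_X)^ell`», themselves «induced by the
quotients `Δ_X ↠ Δ^Θ_X ↠ Δ^ell_X`», `Δ^Θ_X = Δ_X/[Δ_X,[Δ_X,Δ_X]]`) and Thm. 1.6 (ii) p. 24 («`γ` induces an isomorphism
`(Δ_Θ)α →̃ (Δ_Θ)β`»), whose typed carrier is abc-iut-L2-t1's `ThetaSetting.ThetaCompanion γ` (`TemperedRigidity.lean`:
«in print this follows because the theta quotient is defined group-theoretically from `Δ^tp_X`, which `γ` preserves by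
[AbsAnab] Lem. 1.3.8»). [cite: MochizukiEtTh2009, Thm 1.6 (ii) p.24] [SemiAnbd] §6 p. 69 (profinite completion
`Π^temp ↪ Π`; universal property = abc-iut-w5-d139's `IsProfiniteCompletion.exists_extension` / `extension_unique`).

abc-iut cell (WAVE-5 seat abc-iut-w5-d072; cone of [IUTchIII] Cor. 3.12, support piece for GAP row G-w4d010-2 residual
(R1b) «a theta companion of the pointed inversion `ι`», plan/GAP-LEDGER.md D-G-w4d010-2f). WHAT IS CONSTRUCTED (data
definitions, no `Prop`-valued definition, no new named fact), in the ONE-OBJECT case `Dα = Dβ = D` and for an automorphism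
`ι` of `Π^tp_X` PRESERVING THE GEOMETRIC SUBGROUP (`ι(Δ^tp_X) = Δ^tp_X` — the [AbsAnab] Lem. 1.3.8 input, kept as the named
hypothesis `hΔ`, exactly as print uses it):
* §A (generic `X : TemperedCurve p`): `TemperedCurve.completionAut X α : Π_X ≃ₜ* Π_X`, THE topological automorphism of
  the profinite completion extending `α` (`completionAut_toHat : α̂ ∘ ι_X = ι_X ∘ α`), and `map_deltaHat_completionAut`:
  `α(Δ^tp_X) = Δ^tp_X ⇒ α̂(Δ_X) = Δ_X` (`Δ_X` = closure of the image of `Δ^tp_X`; closure commutes with topological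
  isomorphisms — the tree's `DLocObj.map_topologicalClosure_equiv`); hence `α̂` stabilises the closures of
  `[Δ_X,Δ_X]` and `[[Δ_X,Δ_X],Δ_X]` (`map_closure_commutator_completionAut`, `map_closure_commutator₃_completionAut`).
* §B (`D : ThetaSetting p`): by the root fields `ker_toTheta` / `ker_toEll` (the kernels are the `toHat`-preimages of those
  closures) `ι` stabilises `Ker(Π^tp_X ↠ (Π^tp_X)^Θ)` and `Ker(Π^tp_X ↠ (Π^tp_X)^ell)` (`mem_ker_toTheta_iff_of_map_deltaTemp`,
  `mem_ker_toEll_iff_of_map_deltaTemp`); so `ι` DESCENDS to a group automorphism `thetaAutOfAut` of `(Π^tp_X)^Θ`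
  (`thetaAutOfAut_toTheta : ι^Θ ∘ (·)^Θ = (·)^Θ ∘ ι`), continuous in both directions as soon as `toTheta` is a
  topological quotient map (hypothesis `hq` — the root `Setting.lean` gives `(Π^tp_X)^Θ` an ABSTRACT topology of which only
  `Continuous toTheta` is recorded; same hypothesis as `Discharge/Sec2ProfiniteYTheta.lean`), and mapping `Δ_Θ = Ker((·)^ell)`
  onto itself: **`ThetaSetting.thetaCompanionOfAut ι hΔ hq : ThetaCompanion ι`**.
HONEST FRAMING: [EtTh] is refereed; the inputs `hΔ`, `hq` are named hypotheses, nothing else is assumed; nothing here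
takes a side on [IUTchIII] Cor. 3.12; typed ≠ proved for the consumers' remaining inputs.
-/

noncomputable section

open Topology

/-! ## §A. The automorphism of the profinite completion induced by an automorphism of `Π^temp` -/

namespace Literature.AnabelianGeometry.SemiGraphs

namespace TemperedCurve

variable {p : ℕ} [Fact p.Prime] (X : TemperedCurve p) (α : X.PiTemp ≃ₜ* X.PiTemp)

/-- `α` as a continuous monoid homomorphism. [cite: MochizukiSemiAnbd2006, §6 p.69] -/
abbrev autHom : X.PiTemp →ₜ* X.PiTemp :=
  { toMonoidHom := α.toMulEquiv.toMonoidHom, continuous_toFun := α.continuous }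

/-- Existence of the extension of `ι_X ∘ α : Π^temp_X → Π_X` along `ι_X : Π^temp_X → Π_X` (universal property of the
profinite completion, `IsProfiniteCompletion.exists_extension`). [cite: MochizukiSemiAnbd2006, §6 p.69] -/
theorem exists_completionMap : ∃ Φ : X.PiHat →ₜ* X.PiHat, ∀ x : X.PiTemp, Φ (X.toHat x) = X.toHat (α x) := by
  haveI : CompactSpace X.PiHat := X.isProfiniteCompletion_toHat.compactSpace
  haveI : TotallyDisconnectedSpace X.PiHat := X.isProfiniteCompletion_toHat.totallyDisconnectedSpace
  obtain ⟨Φ, hΦ⟩ :=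
    IsProfiniteCompletion.exists_extension X.isProfiniteCompletion_toHat (X.toHat.comp (X.autHom α))
  exact ⟨Φ, fun x => hΦ x⟩

/-- The continuous endomorphism `α̂` of `Π_X` extending `α` (a choice; unique by density). [cite: MochizukiSemiAnbd2006, §6 p.69] -/
def completionMap : X.PiHat →ₜ* X.PiHat :=
  Classical.choose (X.exists_completionMap α)

/-- `α̂ ∘ ι_X = ι_X ∘ α`. [cite: MochizukiSemiAnbd2006, §6 p.69] -/
theorem completionMap_toHat (x : X.PiTemp) : X.completionMap α (X.toHat x) = X.toHat (α x) :=
  Classical.choose_spec (X.exists_completionMap α) x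

/-- `α̂ ∘ (α⁻¹)^ = id` (uniqueness of extensions, `ι_X(Π^temp_X)` dense, `Π_X` Hausdorff). [cite: MochizukiSemiAnbd2006, §6 p.69] -/
theorem completionMap_comp_symm :
    (X.completionMap α).comp (X.completionMap α.symm) = ContinuousMonoidHom.id X.PiHat := by
  haveI : T2Space X.PiHat := X.isProfiniteCompletion_toHat.t2Space
  refine IsProfiniteCompletion.extension_unique X.isProfiniteCompletion_toHat _ _ fun x => ?_
  change X.completionMap α (X.completionMap α.symm (X.toHat x)) = X.toHat x
  rw [completionMap_toHat, completionMap_toHat, ContinuousMulEquiv.apply_symm_apply]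

/-- `α̂ ((α⁻¹)^ z) = z`. [cite: MochizukiSemiAnbd2006, §6 p.69] -/
theorem completionMap_completionMap_symm (z : X.PiHat) :
    X.completionMap α (X.completionMap α.symm z) = z :=
  DFunLike.congr_fun (X.completionMap_comp_symm α) z

/-- `(α⁻¹)^ (α̂ z) = z`. [cite: MochizukiSemiAnbd2006, §6 p.69] -/
theorem completionMap_symm_completionMap (z : X.PiHat) :
    X.completionMap α.symm (X.completionMap α z) = z := by
  have h := X.completionMap_completionMap_symm α.symm z
  rwa [ContinuousMulEquiv.symm_symm] at h

/-- **`α̂ : Π_X ≃ₜ* Π_X`, the topological automorphism of the profinite completion induced by `α`** (inverse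
`(α⁻¹)^`). DEFINED. [cite: MochizukiSemiAnbd2006, §6 p.69] -/
def completionAut : X.PiHat ≃ₜ* X.PiHat where
  toMulEquiv := MonoidHom.toMulEquiv (X.completionMap α).toMonoidHom (X.completionMap α.symm).toMonoidHom
    (MonoidHom.ext fun z => X.completionMap_symm_completionMap α z)
    (MonoidHom.ext fun z => X.completionMap_completionMap_symm α z)
  continuous_toFun := (X.completionMap α).continuous
  continuous_invFun := (X.completionMap α.symm).continuous

/-- `α̂` is `completionMap` as a function. [cite: MochizukiSemiAnbd2006, §6 p.69] -/
@[simp] theorem completionAut_apply (z : X.PiHat) : X.completionAut α z = X.completionMap α z := rfl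

/-- **`α̂ ∘ ι_X = ι_X ∘ α`.** [cite: MochizukiSemiAnbd2006, §6 p.69] -/
theorem completionAut_toHat (x : X.PiTemp) : X.completionAut α (X.toHat x) = X.toHat (α x) :=
  X.completionMap_toHat α x

/-- As monoid homomorphisms: `α̂ ∘ ι_X = ι_X ∘ α`. [cite: MochizukiSemiAnbd2006, §6 p.69] -/
theorem completionAut_comp_toHat :
    (X.completionAut α).toMulEquiv.toMonoidHom.comp X.toHat.toMonoidHom =
      X.toHat.toMonoidHom.comp α.toMulEquiv.toMonoidHom :=
  MonoidHom.ext fun x => X.completionAut_toHat α x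

/-- **`α(Δ^tp_X) = Δ^tp_X ⇒ α̂(Δ_X) = Δ_X`** (`Δ_X` = the closure of `ι_X(Δ^tp_X)` in `Π_X`, [SemiAnbd] p. 69).
[cite: MochizukiSemiAnbd2006, §6 p.69] -/
theorem map_deltaHat_completionAut (hΔ : X.DeltaTemp.map α.toMulEquiv.toMonoidHom = X.DeltaTemp) :
    X.DeltaHat.map (X.completionAut α).toMulEquiv.toMonoidHom = X.DeltaHat := by
  unfold DeltaHat
  rw [DLocObj.map_topologicalClosure_equiv, Subgroup.map_map, completionAut_comp_toHat, ← Subgroup.map_map, hΔ]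

/-- `α̂` stabilises the closure of `[Δ_X, Δ_X]`. [cite: MochizukiEtTh2009, §1 p.12] -/
theorem map_closure_commutator_completionAut (hΔ : X.DeltaTemp.map α.toMulEquiv.toMonoidHom = X.DeltaTemp) :
    (⁅X.DeltaHat, X.DeltaHat⁆.topologicalClosure).map (X.completionAut α).toMulEquiv.toMonoidHom =
      ⁅X.DeltaHat, X.DeltaHat⁆.topologicalClosure := by
  rw [DLocObj.map_topologicalClosure_equiv, Subgroup.map_commutator, X.map_deltaHat_completionAut α hΔ]

/-- `α̂` stabilises the closure of `[[Δ_X, Δ_X], Δ_X]`. [cite: MochizukiEtTh2009, §1 p.12] -/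
theorem map_closure_commutator₃_completionAut (hΔ : X.DeltaTemp.map α.toMulEquiv.toMonoidHom = X.DeltaTemp) :
    (⁅⁅X.DeltaHat, X.DeltaHat⁆, X.DeltaHat⁆.topologicalClosure).map (X.completionAut α).toMulEquiv.toMonoidHom =
      ⁅⁅X.DeltaHat, X.DeltaHat⁆, X.DeltaHat⁆.topologicalClosure := by
  rw [DLocObj.map_topologicalClosure_equiv, Subgroup.map_commutator, Subgroup.map_commutator,
    X.map_deltaHat_completionAut α hΔ]

/-- Pull-back along `ι_X` of an `α̂`-stable subgroup is `α`-stable (membership form).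
[cite: MochizukiSemiAnbd2006, §6 p.69] -/
theorem mem_comap_toHat_iff_of_map_completionAut (K : Subgroup X.PiHat)
    (hK : K.map (X.completionAut α).toMulEquiv.toMonoidHom = K) (x : X.PiTemp) :
    x ∈ K.comap X.toHat.toMonoidHom ↔ α x ∈ K.comap X.toHat.toMonoidHom := by
  rw [Subgroup.mem_comap, Subgroup.mem_comap]
  change X.toHat x ∈ K ↔ X.toHat (α x) ∈ K
  rw [← completionAut_toHat]
  constructor
  · intro hx
    rw [← hK]
    exact ⟨X.toHat x, hx, rfl⟩
  · intro hx
    rw [← hK] at hx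
    obtain ⟨y, hy, hyx⟩ := hx
    have : y = X.toHat x := (X.completionAut α).injective hyx
    rwa [this] at hy

end TemperedCurve

end Literature.AnabelianGeometry.SemiGraphs

/-! ## §B. The theta companion of an automorphism of `Π^tp_X` preserving `Δ^tp_X` -/

namespace Literature.AnabelianGeometry.EtaleTheta

namespace ThetaSetting

open Literature.AnabelianGeometry.SemiGraphs

variable {p : ℕ} [Fact p.Prime] (D : ThetaSetting p) (ι : D.PiTemp ≃ₜ* D.PiTemp)
  (hΔ : D.DeltaTemp.map ι.toMulEquiv.toMonoidHom = D.DeltaTemp)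

include hΔ in
/-- **`ι` stabilises `Ker(Π^tp_X ↠ (Π^tp_X)^Θ)`** when `ι(Δ^tp_X) = Δ^tp_X`: the kernel is the `toHat`-preimage of the closure of
`[[Δ_X,Δ_X],Δ_X]` (root field `ker_toTheta`, p. 12), which `ι̂` stabilises. [cite: MochizukiEtTh2009, §1 p.12] -/
theorem mem_ker_toTheta_iff_of_map_deltaTemp (x : D.PiTemp) : x ∈ D.toTheta.ker ↔ ι x ∈ D.toTheta.ker := by
  rw [D.ker_toTheta]
  exact D.toTemperedCurve.mem_comap_toHat_iff_of_map_completionAut ι _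
    (D.toTemperedCurve.map_closure_commutator₃_completionAut ι hΔ) x

include hΔ in
/-- **`ι` stabilises `Ker(Π^tp_X ↠ (Π^tp_X)^ell)`** when `ι(Δ^tp_X) = Δ^tp_X` (root field `ker_toEll`: the `toHat`-preimage of the
closure of `[Δ_X,Δ_X]`). [cite: MochizukiEtTh2009, §1 p.12] -/
theorem mem_ker_toEll_iff_of_map_deltaTemp (x : D.PiTemp) :
    x ∈ (D.thetaToEll.comp D.toTheta).ker ↔ ι x ∈ (D.thetaToEll.comp D.toTheta).ker := by
  rw [D.ker_toEll]
  exact D.toTemperedCurve.mem_comap_toHat_iff_of_map_completionAut ι _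
    (D.toTemperedCurve.map_closure_commutator_completionAut ι hΔ) x

/-! ### Descending `ι` to `(Π^tp_X)^Θ` -/

section Descent

variable (hK : ∀ x : D.PiTemp, x ∈ D.toTheta.ker ↔ ι x ∈ D.toTheta.ker)

/-- The function `(Π^tp_X)^Θ → (Π^tp_X)^Θ`, `(x)^Θ ↦ (ι x)^Θ` (through a chosen preimage; well defined by `hK`).
[cite: MochizukiEtTh2009, Thm 1.6 (ii) p.24] -/
def thetaFunOfAut : D.GtpTheta → D.GtpTheta := fun y =>
  D.toTheta (ι (Function.surjInv D.toTheta_surjective y))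

include hK in
/-- `ι^Θ ((x)^Θ) = (ι x)^Θ` — independence of the preimage. [cite: MochizukiEtTh2009, Thm 1.6 (ii) p.24] -/
theorem thetaFunOfAut_toTheta (x : D.PiTemp) : D.thetaFunOfAut ι (D.toTheta x) = D.toTheta (ι x) := by
  unfold thetaFunOfAut
  set x' := Function.surjInv D.toTheta_surjective (D.toTheta x) with hx'
  have hxx' : D.toTheta x' = D.toTheta x := Function.surjInv_eq D.toTheta_surjective (D.toTheta x)
  have hmem : x' * x⁻¹ ∈ D.toTheta.ker := by
    rw [MonoidHom.mem_ker, map_mul, map_inv, hxx', mul_inv_cancel]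
  have hmem' := (hK _).mp hmem
  rw [MonoidHom.mem_ker, map_mul, map_inv, map_mul, map_inv, mul_inv_eq_one] at hmem'
  exact hmem'

/-- `ι^Θ` as a group endomorphism of `(Π^tp_X)^Θ`. [cite: MochizukiEtTh2009, Thm 1.6 (ii) p.24] -/
def thetaHomOfAut : D.GtpTheta →* D.GtpTheta where
  toFun := D.thetaFunOfAut ι
  map_one' := by
    rw [← (map_one D.toTheta), D.thetaFunOfAut_toTheta ι hK, map_one, map_one]
  map_mul' y₁ y₂ := by
    obtain ⟨x₁, rfl⟩ := D.toTheta_surjective y₁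
    obtain ⟨x₂, rfl⟩ := D.toTheta_surjective y₂
    rw [← map_mul, D.thetaFunOfAut_toTheta ι hK, D.thetaFunOfAut_toTheta ι hK, D.thetaFunOfAut_toTheta ι hK,
      map_mul, map_mul]

/-- `ι^Θ ((x)^Θ) = (ι x)^Θ` for the endomorphism. [cite: MochizukiEtTh2009, Thm 1.6 (ii) p.24] -/
@[simp] theorem thetaHomOfAut_toTheta (x : D.PiTemp) : D.thetaHomOfAut ι hK (D.toTheta x) = D.toTheta (ι x) :=
  D.thetaFunOfAut_toTheta ι hK x

include hK in
/-- The kernel hypothesis for `ι⁻¹` follows from that for `ι`. [cite: MochizukiEtTh2009, Thm 1.6 (ii) p.24] -/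
theorem ker_iff_symm : ∀ x : D.PiTemp, x ∈ D.toTheta.ker ↔ ι.symm x ∈ D.toTheta.ker := fun x => by
  rw [hK (ι.symm x), ContinuousMulEquiv.apply_symm_apply]

/-- `(ι⁻¹)^Θ (ι^Θ y) = y`. [cite: MochizukiEtTh2009, Thm 1.6 (ii) p.24] -/
theorem thetaHomOfAut_symm_comp :
    (D.thetaHomOfAut ι.symm (D.ker_iff_symm ι hK)).comp (D.thetaHomOfAut ι hK) = MonoidHom.id _ := by
  ext y
  obtain ⟨x, rfl⟩ := D.toTheta_surjective y
  rw [MonoidHom.comp_apply, thetaHomOfAut_toTheta, thetaHomOfAut_toTheta, ContinuousMulEquiv.symm_apply_apply,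
    MonoidHom.id_apply]

/-- `ι^Θ ((ι⁻¹)^Θ y) = y`. [cite: MochizukiEtTh2009, Thm 1.6 (ii) p.24] -/
theorem thetaHomOfAut_comp_symm :
    (D.thetaHomOfAut ι hK).comp (D.thetaHomOfAut ι.symm (D.ker_iff_symm ι hK)) = MonoidHom.id _ := by
  ext y
  obtain ⟨x, rfl⟩ := D.toTheta_surjective y
  rw [MonoidHom.comp_apply, thetaHomOfAut_toTheta, thetaHomOfAut_toTheta, ContinuousMulEquiv.apply_symm_apply,
    MonoidHom.id_apply]

variable (hq : IsQuotientMap D.toTheta)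

include hK hq in
/-- `ι^Θ` is continuous when `toTheta` is a topological quotient map (`ι^Θ ∘ (·)^Θ = (·)^Θ ∘ ι` is continuous).
[cite: MochizukiEtTh2009, Thm 1.6 (ii) p.24] -/
theorem continuous_thetaHomOfAut : Continuous (D.thetaHomOfAut ι hK) := by
  rw [hq.continuous_iff]
  have h : (D.thetaHomOfAut ι hK : D.GtpTheta → D.GtpTheta) ∘ D.toTheta = D.toTheta ∘ ι :=
    funext fun x => D.thetaHomOfAut_toTheta ι hK x
  rw [h]
  exact D.continuous_toTheta.comp ι.continuous

/-- **`ι^Θ : (Π^tp_X)^Θ ≃ₜ* (Π^tp_X)^Θ`**, the topological automorphism of the theta quotient induced by `ι` (for `ι`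
stabilising `Ker((·)^Θ)` and `toTheta` a topological quotient map). DEFINED. [cite: MochizukiEtTh2009, Thm 1.6 (ii) p.24] -/
def thetaAutOfAut : D.GtpTheta ≃ₜ* D.GtpTheta where
  toMulEquiv := MonoidHom.toMulEquiv (D.thetaHomOfAut ι hK) (D.thetaHomOfAut ι.symm (D.ker_iff_symm ι hK))
    (D.thetaHomOfAut_symm_comp ι hK) (D.thetaHomOfAut_comp_symm ι hK)
  continuous_toFun := D.continuous_thetaHomOfAut ι hK hq
  continuous_invFun := D.continuous_thetaHomOfAut ι.symm (D.ker_iff_symm ι hK)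
    (by exact hq)

/-- **`ι^Θ ((x)^Θ) = (ι x)^Θ`.** [cite: MochizukiEtTh2009, Thm 1.6 (ii) p.24] -/
@[simp] theorem thetaAutOfAut_toTheta (x : D.PiTemp) : D.thetaAutOfAut ι hK hq (D.toTheta x) = D.toTheta (ι x) :=
  D.thetaFunOfAut_toTheta ι hK x

end Descent

/-- **[EtTh] Thm. 1.6 (ii)'s theta companion, CONSTRUCTED for an automorphism `ι` of `Π^tp_X` with `ι(Δ^tp_X) = Δ^tp_X`**
(«`γ` induces an isomorphism `(Δ_Θ)α →̃ (Δ_Θ)β`», p. 24; one-object case, `toTheta` a topological quotient map): `thetaIso :=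
ι^Θ`, compatible with `ι` and the quotient map by construction, and carrying `Δ_Θ = Ker((Π^tp_X)^Θ ↠ (Π^tp_X)^ell)` onto itself
because `ι` also stabilises `Ker(Π^tp_X ↠ (Π^tp_X)^ell)`. DEFINED (an inhabitant of abc-iut-L2-t1's `ThetaCompanion ι`).
[cite: MochizukiEtTh2009, Thm 1.6 (ii) p.24] -/
def thetaCompanionOfAut (hq : IsQuotientMap D.toTheta) : ThetaCompanion ι where
  thetaIso := D.thetaAutOfAut ι (D.mem_ker_toTheta_iff_of_map_deltaTemp ι hΔ) hq
  comm x := (D.thetaAutOfAut_toTheta ι (D.mem_ker_toTheta_iff_of_map_deltaTemp ι hΔ) hq x).symm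
  map_deltaTheta := by
    have hK := D.mem_ker_toTheta_iff_of_map_deltaTemp ι hΔ
    have hE := D.mem_ker_toEll_iff_of_map_deltaTemp ι hΔ
    ext y
    obtain ⟨x, rfl⟩ := D.toTheta_surjective y
    -- `Δ_Θ = Ker thetaToEll`; membership of `(x)^Θ` is membership of `x` in `Ker(thetaToEll ∘ toTheta)`
    have hmem : ∀ z : D.PiTemp, D.toTheta z ∈ D.DeltaTheta ↔ z ∈ (D.thetaToEll.comp D.toTheta).ker := fun z => by
      rw [DeltaTheta, MonoidHom.mem_ker, MonoidHom.mem_ker, MonoidHom.comp_apply]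
    constructor
    · rintro ⟨w, hw, hwx⟩
      obtain ⟨z, rfl⟩ := D.toTheta_surjective w
      change D.thetaAutOfAut ι hK hq (D.toTheta z) = D.toTheta x at hwx
      rw [thetaAutOfAut_toTheta] at hwx
      rw [← hwx, hmem, ← hE z, ← hmem]
      exact hw
    · intro hx
      refine ⟨D.toTheta (ι.symm x), ?_, ?_⟩
      · change D.toTheta (ι.symm x) ∈ D.DeltaTheta
        rw [hmem, hE, ContinuousMulEquiv.apply_symm_apply, ← hmem]
        exact hx
      · change D.thetaAutOfAut ι hK hq (D.toTheta (ι.symm x)) = D.toTheta x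
        rw [thetaAutOfAut_toTheta, ContinuousMulEquiv.apply_symm_apply]

/-- The companion's isomorphism on `(x)^Θ` is `(ι x)^Θ`. [cite: MochizukiEtTh2009, Thm 1.6 (ii) p.24] -/
@[simp] theorem thetaCompanionOfAut_thetaIso_toTheta (hq : IsQuotientMap D.toTheta) (x : D.PiTemp) :
    (D.thetaCompanionOfAut ι hΔ hq).thetaIso (D.toTheta x) = D.toTheta (ι x) :=
  D.thetaAutOfAut_toTheta ι _ hq x

end ThetaSetting

end Literature.AnabelianGeometry.EtaleTheta

end
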